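import Summits.SmoothPoincare4.SmoothPoincare4.Theorems.SullivanDualWitnessChargeHelperFlatMemberIsFarLine
import Summits.SmoothPoincare4.SmoothPoincare4.Theorems.SullivanDualWitnessChargeHelperMemberSlab
import Summits.SmoothPoincare4.SmoothPoincare4.Theorems.SullivanDualWitnessChargeHelperMemberEventuallyInBall
import Summits.SmoothPoincare4.SmoothPoincare4.Theorems.SullivanDualWitnessChargeHelperEndHolomorphic
import Summits.SmoothPoincare4.SmoothPoincare4.Theorems.SullivanDualWitnessChargeFlatChart
import Mathlib.Analysis.Complex.RemovableSingularity
import Mathlib.Analysis.Complex.AbsMax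
import Mathlib.Analysis.Normed.Field.Lemmas

/-!
# Members of far intercept are the far flat lines (FARU)

Crux `WitnessCharge` (stmt-SmoothPoincare4-7824), line `Sketch`, skeleton v7, stub
`helper_farMemberIsFarLine`.

For `J` STANDARD on the punctured `ε'`-chart-ball `B_{ε'}` at `p` (closed `ε'`-ball inside the
chart target), a pencil member `u : ℂ → Σ ∖ p` of intercept `b` with `‖b‖ > ε'⁻¹` never leaves
`B_{ε'}`, hence (by the landed rigidity `helper_flatMemberIsFarLine`) it IS the far flat line:
`Ycoord p (u ξ) = (ξ, b)` for every `ξ`.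

Proof (flat-region complex analysis only; no `J`-curve theory). Let `G = u⁻¹(B_{ε'})` (open) and
`W = (Ycoord p ∘ u).2` the transverse flat coordinate, complex differentiable on `G`
(`helper_endHolomorphic`), with `W → b` at infinity, `G ⊇ {‖ξ‖ > r}`
(`helper_memberEventuallyInBall`) and the slab bound `‖W‖ ≤ max ε'⁻¹ ‖b‖ = ‖b‖` on `G`
(`helper_memberSlab`).

* **Maximum modulus at infinity** (`exists_forall_eq_of_norm_le_of_tendsto_cocompact`):
  `z ↦ W z⁻¹` extends continuously by `b` across `0`, hence analytically (removable singularity,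
  `Complex.analyticAt_of_differentiable_on_punctured_nhds_of_continuousAt`), and its norm has a
  local maximum at `0`, so it is locally constant (`Complex.eventually_eq_of_isLocalMax_norm`):
  `W = b` outside a disc.
* **Boundary values**: `G ⊆ C = u⁻¹(closed chart ball of radius ε')`, a closed set
  (`isClosed_closedChartBall`) on which `Ycoord p ∘ u` is continuous
  (`continuousAt_Ycoord_of_mem_source`: the chart is continuous on its source and `ι` away from
  `0`), and on `C ∖ G` the chart distance is exactly `ε'`, so `‖W‖ ≤ ε'⁻¹ < ‖b‖` there
  (`norm_Ycoord_snd_le`).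
* **Clopen argument** (`eq_univ_of_eqOn_far`): the set `E` of points near which `u` stays in the
  ball and `W = b` is open, nonempty (it contains the exterior of a disc), and closed: at a limit
  point inside `G` the identity principle (`AnalyticAt.frequently_eq_iff_eventually_eq`) applies,
  and a limit point outside `G` would be a point of `C ∖ G` with `W = b` by continuity,
  contradicting `‖W‖ < ‖b‖` there. So `E = ℂ` (`IsClopen.eq_univ`), `G = ℂ`, and
  `helper_flatMemberIsFarLine` concludes.

References: M. Gromov, *Pseudo holomorphic curves in symplectic manifolds*, Invent. Math. 82
(1985), §2.4.A [Gromov1985].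
-/

noncomputable section

set_option linter.dupNamespace false

open scoped Manifold ContDiff Topology
open Set Filter Literature.Geometry.Kaehler Literature.Geometry.Symplectic
  Literature.Topology.FourManifolds

namespace Summit.SmoothPoincare4.SmoothPoincare4.Theorems.WitnessCharge.PencilIncompleteness

/-! ### Two facts of one complex variable -/

/-- **Maximum modulus at infinity.** A function `W : ℂ → ℂ` which, outside the disc of radius
`r`, is complex differentiable and of norm `≤ ‖b‖`, and which tends to `b` at infinity, equals `b`
outside a larger disc: `z ↦ W z⁻¹` extends continuously by `b` across `0`, hence analytically
(removable singularity), and its norm has a local maximum at `0`, so it is locally constant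
(maximum modulus principle). -/
theorem exists_forall_eq_of_norm_le_of_tendsto_cocompact {W : ℂ → ℂ} {b : ℂ} {r : ℝ}
    (hdiff : ∀ ξ : ℂ, r < ‖ξ‖ → DifferentiableAt ℂ W ξ)
    (hle : ∀ ξ : ℂ, r < ‖ξ‖ → ‖W ξ‖ ≤ ‖b‖)
    (hlim : Tendsto W (cocompact ℂ) (𝓝 b)) :
    ∃ R : ℝ, ∀ ξ : ℂ, R < ‖ξ‖ → W ξ = b := by
  classical
  -- WLOG the radius is positive
  set r' : ℝ := max r 1
  have hr'pos : 0 < r' := one_pos.trans_le (le_max_right _ _)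
  have hrr' : r ≤ r' := le_max_left _ _
  -- the inverted function, extended by `b` across `0`
  set g : ℂ → ℂ := Function.update (fun z : ℂ => W z⁻¹) 0 b with hg
  have hg0 : g 0 = b := Function.update_self _ _ _
  have hgz : ∀ z : ℂ, z ≠ 0 → g z = W z⁻¹ := fun z hz => Function.update_of_ne hz _ _
  -- small nonzero `z` have `r < ‖z⁻¹‖`
  have hsmall : ∀ z : ℂ, z ≠ 0 → ‖z‖ < r'⁻¹ → r < ‖z⁻¹‖ := by
    intro z hz hzr
    rw [norm_inv]
    exact hrr'.trans_lt ((lt_inv_comm₀ (norm_pos_iff.2 hz) hr'pos).1 hzr)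
  -- continuity at `0`: `W z⁻¹ → b` as `z → 0`, `z ≠ 0`
  have hcont : ContinuousAt g 0 := by
    rw [hg, continuousAt_update_same]
    have h1 : Tendsto (fun z : ℂ => z⁻¹) (𝓝[≠] (0 : ℂ)) (cocompact ℂ) := by
      rw [← Metric.cobounded_eq_cocompact]
      exact Filter.tendsto_inv₀_nhdsNE_zero
    exact hlim.comp h1
  -- complex differentiability on a punctured neighbourhood of `0`
  have hpunct : ∀ᶠ z in 𝓝[≠] (0 : ℂ), DifferentiableAt ℂ g z := by
    rw [eventually_nhdsWithin_iff]
    filter_upwards [Metric.ball_mem_nhds (0 : ℂ) (inv_pos.2 hr'pos)] with z hz hz0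
    rw [Metric.mem_ball, dist_zero_right] at hz
    have h1 : DifferentiableAt ℂ (fun z : ℂ => W z⁻¹) z :=
      (hdiff _ (hsmall z hz0 hz)).comp z (differentiableAt_inv hz0)
    refine h1.congr_of_eventuallyEq ?_
    filter_upwards [isOpen_ne.mem_nhds hz0] with y hy
    exact hgz y hy
  have han : AnalyticAt ℂ g 0 :=
    Complex.analyticAt_of_differentiable_on_punctured_nhds_of_continuousAt hpunct hcont
  have hd : ∀ᶠ z in 𝓝 (0 : ℂ), DifferentiableAt ℂ g z :=
    han.eventually_analyticAt.mono fun z hz => hz.differentiableAt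
  -- `‖g‖` has a local maximum at `0`
  have hmax : IsLocalMax (norm ∘ g) 0 := by
    show ∀ᶠ z in 𝓝 (0 : ℂ), (norm ∘ g) z ≤ (norm ∘ g) 0
    filter_upwards [Metric.ball_mem_nhds (0 : ℂ) (inv_pos.2 hr'pos)] with z hz
    rw [Metric.mem_ball, dist_zero_right] at hz
    simp only [Function.comp_apply, hg0]
    rcases eq_or_ne z 0 with rfl | hz0
    · rw [hg0]
    · rw [hgz z hz0]
      exact hle _ (hsmall z hz0 hz)
  -- so `g` is locally constant at `0`
  have hev : ∀ᶠ z in 𝓝 (0 : ℂ), g z = g 0 := Complex.eventually_eq_of_isLocalMax_norm hd hmax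
  obtain ⟨δ, hδ, hδW⟩ := Metric.eventually_nhds_iff.1 hev
  refine ⟨δ⁻¹, fun ξ hξ => ?_⟩
  have hξpos : 0 < ‖ξ‖ := (inv_pos.2 hδ).trans hξ
  have hξ0 : ξ ≠ 0 := norm_pos_iff.1 hξpos
  have h1 : dist ξ⁻¹ 0 < δ := by
    rw [dist_zero_right, norm_inv]
    exact (inv_lt_comm₀ hξpos hδ).2 hξ
  have h2 := hδW h1
  rwa [hg0, hgz _ (inv_ne_zero hξ0), inv_inv] at h2

/-- **Clopen argument.** Let `G ⊆ C ⊆ ℂ` with `G` open and `C` closed, and let `W : ℂ → ℂ` be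
complex differentiable on `G`, continuous at every point of `C`, with `‖W‖ < ‖b‖` on `C ∖ G`. If
`G` contains the exterior of a disc and `W = b` there, then `G = ℂ`: the set `E` of points near
which `· ∈ G ∧ W = b` holds is open, nonempty, and closed (identity principle at limit points in
`G`; at a limit point outside `G`, continuity would give `W = b` on `C ∖ G`). -/
theorem eq_univ_of_eqOn_far {W : ℂ → ℂ} {G C : Set ℂ} {b : ℂ} {R : ℝ}
    (hG : IsOpen G) (hC : IsClosed C) (hGC : G ⊆ C)
    (hdiff : DifferentiableOn ℂ W G)
    (hcont : ∀ ξ ∈ C, ContinuousAt W ξ)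
    (hbdry : ∀ ξ ∈ C, ξ ∉ G → ‖W ξ‖ < ‖b‖)
    (hR : ∀ ξ : ℂ, R < ‖ξ‖ → ξ ∈ G ∧ W ξ = b) : G = univ := by
  set E : Set ℂ := {ξ | ∀ᶠ ζ in 𝓝 ξ, ζ ∈ G ∧ W ζ = b}
  have hEG : E ⊆ G := fun ξ hξ => (Filter.Eventually.self_of_nhds hξ).1
  have hEW : ∀ ξ ∈ E, W ξ = b := fun ξ hξ => (Filter.Eventually.self_of_nhds hξ).2
  have hEopen : IsOpen E := isOpen_setOf_eventually_nhds
  -- nonempty: a point outside the disc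
  have hEne : E.Nonempty := by
    refine ⟨((|R| + 1 : ℝ) : ℂ), ?_⟩
    have hlt : R < ‖((|R| + 1 : ℝ) : ℂ)‖ := by
      rw [Complex.norm_real, Real.norm_of_nonneg (by positivity)]
      exact (le_abs_self R).trans_lt (lt_add_one _)
    show ∀ᶠ ζ in 𝓝 _, ζ ∈ G ∧ W ζ = b
    filter_upwards [(isOpen_lt continuous_const continuous_norm).mem_nhds hlt] with ζ hζ
    exact hR ζ hζ
  -- closed
  have hEclosed : IsClosed E := by
    rw [isClosed_iff_frequently]
    intro ξ hfr
    -- `ξ ∈ closure E ⊆ C`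
    have hξC : ξ ∈ C :=
      hC.closure_subset_iff.2 (hEG.trans hGC) (mem_closure_iff_frequently.2 hfr)
    -- `W ξ = b` by continuity at `ξ`
    have hWξ : W ξ = b := by
      have hfrW : ∃ᶠ y in 𝓝 ξ, W y ∈ ({b} : Set ℂ) :=
        hfr.mono fun y hy => mem_singleton_iff.2 (hEW y hy)
      have h1 : W ξ ∈ closure ({b} : Set ℂ) :=
        mem_closure_of_frequently_of_tendsto hfrW (hcont ξ hξC)
      rwa [closure_singleton, mem_singleton_iff] at h1
    by_cases hξG : ξ ∈ G
    · -- identity principle at a point of `G`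
      by_cases hξE : ξ ∈ E
      · exact hξE
      have han : AnalyticAt ℂ W ξ := hdiff.analyticAt (hG.mem_nhds hξG)
      have hfr' : ∃ᶠ y in 𝓝[≠] ξ, W y = b := by
        rw [frequently_nhdsWithin_iff]
        exact hfr.mono fun y hy => ⟨hEW y hy, fun h => hξE (mem_singleton_iff.1 h ▸ hy)⟩
      have hev : ∀ᶠ y in 𝓝 ξ, W y = b :=
        (han.frequently_eq_iff_eventually_eq analyticAt_const).1 hfr'
      show ∀ᶠ ζ in 𝓝 ξ, ζ ∈ G ∧ W ζ = b
      filter_upwards [hG.mem_nhds hξG, hev] with ζ h1 h2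
      exact ⟨h1, h2⟩
    · -- a limit point outside `G` is impossible
      exact absurd (hbdry ξ hξC hξG) (by rw [hWξ]; exact lt_irrefl _)
  have hEuniv : E = univ := IsClopen.eq_univ ⟨hEclosed, hEopen⟩ hEne
  exact eq_univ_of_univ_subset (hEuniv ▸ hEG)

/-! ### Continuity of the flat coordinates on the chart source -/

variable {S : HomotopySphere 4} {p : S.carrier}

/-- `Ycoord p` is continuous at every point of `Σ ∖ p` lying in the chart source at `p`: there
`e x − e p ≠ 0` (injectivity of the chart on its source), the chart is continuous, and the
inversion `ι` is continuous away from `0`. -/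
theorem continuousAt_Ycoord_of_mem_source {x : punctured p}
    (hx : x.1 ∈ (chartAt (EuclideanSpace ℝ (Fin 4)) p).source) :
    ContinuousAt (Ycoord p) x := by
  obtain ⟨A, hA, -⟩ := exists_coordCLM
  have hY : Ycoord p =
      (fun y : EuclideanSpace ℝ (Fin 4) => A (inversion (y - extChartAt (𝓡 4) p p))) ∘
        (fun z : punctured p => extChartAt (𝓡 4) p z.1) := by
    funext z
    rw [Function.comp_apply, hA]
    rfl
  have hne : extChartAt (𝓡 4) p x.1 - extChartAt (𝓡 4) p p ≠ 0 := by
    intro h0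
    have h1 : extChartAt (𝓡 4) p x.1 = extChartAt (𝓡 4) p p := sub_eq_zero.1 h0
    have h2 : x.1 = p :=
      (extChartAt (𝓡 4) p).injOn (by rw [extChartAt_source]; exact hx)
        (mem_extChartAt_source (I := 𝓡 4) p) h1
    exact (mem_punctured.1 x.2) h2
  have hE : ContinuousAt (fun z : punctured p => extChartAt (𝓡 4) p z.1) x :=
    (continuousAt_extChartAt' (I := 𝓡 4) (by rw [extChartAt_source]; exact hx)).comp
      continuous_subtype_val.continuousAt
  have hg : ContinuousAt
      (fun y : EuclideanSpace ℝ (Fin 4) => A (inversion (y - extChartAt (𝓡 4) p p)))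
      (extChartAt (𝓡 4) p x.1) := by
    have h1 : ContinuousAt inversion
        ((fun y : EuclideanSpace ℝ (Fin 4) => y - extChartAt (𝓡 4) p p)
          (extChartAt (𝓡 4) p x.1)) :=
      (contDiffAt_inversion (n := ∞) hne).continuousAt
    have h2 : ContinuousAt
        (fun y : EuclideanSpace ℝ (Fin 4) => inversion (y - extChartAt (𝓡 4) p p))
        (extChartAt (𝓡 4) p x.1) :=
      ContinuousAt.comp (g := inversion)
        (f := fun y : EuclideanSpace ℝ (Fin 4) => y - extChartAt (𝓡 4) p p)
        h1 (continuousAt_id.sub continuousAt_const)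
    exact A.continuous.continuousAt.comp h2
  rw [hY]
  exact ContinuousAt.comp (f := fun z : punctured p => extChartAt (𝓡 4) p z.1) (x := x) hg hE

/-! ### The stub -/

/-- **A member of far intercept is the far flat line (FARU).** For `J` standard on the punctured
`ε'`-chart-ball at `p` (closed `ε'`-ball inside the chart target) and a pencil member `u` of
intercept `b` with `ε'⁻¹ < ‖b‖`, every `u ξ` lies in the ball and `Ycoord p (u ξ) = (ξ, b)`.
On `G = u⁻¹(B_{ε'})` the transverse coordinate `W = (Ycoord p ∘ u).2` is holomorphic
(`helper_endHolomorphic`) with `‖W‖ ≤ ‖b‖` (`helper_memberSlab`) and `W → b` at infinity, so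
`W = b` outside a disc (maximum modulus at infinity,
`exists_forall_eq_of_norm_le_of_tendsto_cocompact`); the boundary values of `W` on
`closure G ∖ G` have norm `≤ ε'⁻¹ < ‖b‖`, so the clopen argument `eq_univ_of_eqOn_far` gives
`G = ℂ`, and `helper_flatMemberIsFarLine` identifies `u` with the far line.
(Line `Sketch`, skeleton v7, stub FARU.) -/
theorem helper_farMemberIsFarLine :
    ∀ (S : HomotopySphere 4) (p : S.carrier)
      (J : ∀ x : punctured p, TangentSpace (𝓡 4) x →L[ℝ] TangentSpace (𝓡 4) x) (ε' : ℝ),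
      0 < ε' →
      Metric.closedBall (extChartAt (𝓡 4) p p) ε' ⊆ (extChartAt (𝓡 4) p).target →
      (∀ x : punctured p, InPuncturedChartBall p ε' x →
        ∀ (v : TangentSpace (𝓡 4) x) (b : EuclideanSpace ℝ (Fin 4)),
          inner ℝ (fderiv ℝ inversion (extChartAt (𝓡 4) p x.1 - extChartAt (𝓡 4) p p)
            (mfderiv (𝓡 4) 𝓘(ℝ, EuclideanSpace ℝ (Fin 4))
              (fun z : punctured p => extChartAt (𝓡 4) p z.1) x (J x v))) b
          = stdSymplecticForm (fderiv ℝ inversion (extChartAt (𝓡 4) p x.1 - extChartAt (𝓡 4) p p)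
            (mfderiv (𝓡 4) 𝓘(ℝ, EuclideanSpace ℝ (Fin 4))
              (fun z : punctured p => extChartAt (𝓡 4) p z.1) x v)) b) →
      ∀ (u : ℂ → punctured p) (b : ℂ), IsPencilMember J u b → ε'⁻¹ < ‖b‖ →
        ∀ ξ : ℂ, InPuncturedChartBall p ε' (u ξ) ∧ Ycoord p (u ξ) = (ξ, b) := by
  intro S p J ε' hε' hball hJstd u b hu hb
  have hmem : IsPencilMember J u b := hu
  obtain ⟨hcurve, -, -, -, -, hw⟩ := hu
  have hucont : Continuous u := hcurve.contMDiff.continuous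
  obtain ⟨hGopen, hdiffY, -, -⟩ :=
    helper_endHolomorphic S p J ε' hε' hball hJstd u hcurve.contMDiff hcurve.isJHolomorphic
  -- it suffices that `u` never leaves the ball
  suffices hflat : ∀ ξ : ℂ, InPuncturedChartBall p ε' (u ξ) from
    fun ξ => ⟨hflat ξ, helper_flatMemberIsFarLine S p J ε' u b hε' hball hJstd hmem hflat ξ⟩
  set e := extChartAt (𝓡 4) p
  set G : Set ℂ := {ξ | InPuncturedChartBall p ε' (u ξ)}
  set W : ℂ → ℂ := fun ξ => (Ycoord p (u ξ)).2
  -- the closed set `C = u⁻¹(closed chart ball of radius ε') ⊇ G`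
  set C : Set ℂ := {ξ | (u ξ).1 ∈ (chartAt (EuclideanSpace ℝ (Fin 4)) p).source ∧
    e (u ξ).1 ∈ Metric.closedBall (e p) ε'}
  have hCclosed : IsClosed C :=
    (isClosed_closedChartBall p hball).preimage (continuous_subtype_val.comp hucont)
  have hGC : G ⊆ C := fun ξ hξ => ⟨hξ.1, Metric.ball_subset_closedBall hξ.2⟩
  have hdiff : DifferentiableOn ℂ W G := hdiffY.snd
  have hcont : ∀ ξ ∈ C, ContinuousAt W ξ := fun ξ hξ =>
    continuous_snd.continuousAt.comp
      ((continuousAt_Ycoord_of_mem_source hξ.1).comp hucont.continuousAt)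
  -- boundary values: `‖W‖ ≤ ε'⁻¹ < ‖b‖` on `C ∖ G`
  have hbdry : ∀ ξ ∈ C, ξ ∉ G → ‖W ξ‖ < ‖b‖ := by
    intro ξ hξC hξG
    have hge : ε' ≤ ‖e (u ξ).1 - e p‖ := by
      by_contra hlt
      exact hξG ⟨hξC.1, by rw [Metric.mem_ball, dist_eq_norm]; exact not_le.1 hlt⟩
    exact ((norm_Ycoord_snd_le (u ξ)).trans (inv_anti₀ hε' hge)).trans_lt hb
  -- slab bound and the tail of `G`
  have hslab : ∀ ξ ∈ G, ‖W ξ‖ ≤ ‖b‖ := fun ξ hξ =>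
    (helper_memberSlab S p J ε' u b hε' hball hJstd hmem ξ hξ).trans_eq (max_eq_right hb.le)
  obtain ⟨r, hr⟩ := helper_memberEventuallyInBall S p J u b hmem ε' hε'
  -- maximum modulus at infinity: `W = b` outside a disc
  obtain ⟨R, hR⟩ := exists_forall_eq_of_norm_le_of_tendsto_cocompact
    (fun ξ hξ => hdiff.differentiableAt (hGopen.mem_nhds (hr ξ hξ)))
    (fun ξ hξ => hslab ξ (hr ξ hξ)) hw
  have hfar : ∀ ξ : ℂ, max r R < ‖ξ‖ → ξ ∈ G ∧ W ξ = b := fun ξ hξ =>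
    ⟨hr ξ ((le_max_left _ _).trans_lt hξ), hR ξ ((le_max_right _ _).trans_lt hξ)⟩
  -- clopen argument
  have hGuniv : G = univ := eq_univ_of_eqOn_far hGopen hCclosed hGC hdiff hcont hbdry hfar
  intro ξ
  have hξ : ξ ∈ G := hGuniv ▸ mem_univ ξ
  exact hξ

end Summit.SmoothPoincare4.SmoothPoincare4.Theorems.WitnessCharge.PencilIncompleteness
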